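import Summits.CriticalPhenomena.CardyFormulaZ2.Theorems.CardyMeckeFlipMeckeRigidityDilationAPI

/-!
# Dilations normalise the isometries: the conjugation identity on `ℋ_ℂ`

Route `Summits/CriticalPhenomena/CardyFormulaZ2/Theses/CardyMeckeFlip`, crux `MeckeRigidity`
(item stmt-CriticalPhenomena-14826), line `registered`, similarity-covariance package, stub
`exists_isometry_dilate_comm`.

For `t > 0` and a plane isometry `g`, the conjugate `g' := S_{t⁻¹} ∘ g ∘ S_t`, i.e.
`g' w = t⁻¹ · g (t · w)`, is again an isometry of `ℂ`, and on the Schramm–Smirnov space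
`ℋ_ℂ = QuadConfig univ` one has `S_t ∘ g' = g ∘ S_t` and `g' ∘ S_{t⁻¹} = S_{t⁻¹} ∘ g`.
-/

noncomputable section
open MeasureTheory Set Metric Filter Topology
open Literature.Probability.Percolation Literature.Probability.Percolation.QuadCrossing
namespace Summit.CriticalPhenomena.CardyFormulaZ2.Theorems.CardyMeckeFlip

/-- **Conjugation of isometries by dilations.**  For `t > 0` and `g : ℂ ≃ᵢ ℂ` the map
`g' w = t⁻¹ · g (t · w)` is an isometry of `ℂ` with `S_t (g' · S) = g · (S_t S)` and
`g' · (S_{t⁻¹} S) = S_{t⁻¹} (g · S)` for every configuration `S ∈ ℋ_ℂ`. [folklore] -/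
theorem exists_isometry_dilate_comm : ∀ (t : ℝ) (ht : 0 < t) (g : ℂ ≃ᵢ ℂ), ∃ g' : ℂ ≃ᵢ ℂ, (∀ w : ℂ, g' w = ((t : ℂ))⁻¹ * g ((t : ℂ) * w)) ∧ (∀ S : QuadConfig (Set.univ : Set ℂ), QuadConfig.dilate t ht.ne' (QuadConfig.isometry g' S) = QuadConfig.isometry g (QuadConfig.dilate t ht.ne' S)) ∧ (∀ S : QuadConfig (Set.univ : Set ℂ), QuadConfig.isometry g' (QuadConfig.dilate t⁻¹ (inv_ne_zero ht.ne') S) = QuadConfig.dilate t⁻¹ (inv_ne_zero ht.ne') (QuadConfig.isometry g S)) := by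
  intro t ht g
  have hτ : (t : ℂ) ≠ 0 := Complex.ofReal_ne_zero.mpr ht.ne'
  -- the conjugate `g' = S_{t⁻¹} ∘ g ∘ S_t` as an isometric self-equivalence of `ℂ`
  let e : ℂ ≃ ℂ :=
    { toFun := fun w => ((t : ℂ))⁻¹ * g ((t : ℂ) * w)
      invFun := fun w => ((t : ℂ))⁻¹ * g.symm ((t : ℂ) * w)
      left_inv := fun w => by
        simp only [mul_inv_cancel_left₀ hτ, IsometryEquiv.symm_apply_apply, inv_mul_cancel_left₀ hτ]
      right_inv := fun w => by
        simp only [mul_inv_cancel_left₀ hτ, IsometryEquiv.apply_symm_apply, inv_mul_cancel_left₀ hτ] }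
  have he : Isometry e := by
    refine Isometry.of_dist_eq fun x y => ?_
    show dist (((t : ℂ))⁻¹ * g ((t : ℂ) * x)) (((t : ℂ))⁻¹ * g ((t : ℂ) * y)) = dist x y
    rw [Complex.dist_eq, ← mul_sub, norm_mul, ← Complex.dist_eq, g.dist_eq, Complex.dist_eq,
      ← mul_sub, norm_mul, ← mul_assoc, norm_inv, inv_mul_cancel₀ (norm_ne_zero_iff.mpr hτ), one_mul,
      Complex.dist_eq]
  let g' : ℂ ≃ᵢ ℂ := ⟨e, he⟩
  have hg' : ∀ w : ℂ, g' w = ((t : ℂ))⁻¹ * g ((t : ℂ) * w) := fun _ => rfl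
  have hg's : ∀ w : ℂ, g'.symm w = ((t : ℂ))⁻¹ * g.symm ((t : ℂ) * w) := fun _ => rfl
  -- `S_t ∘ g' = g ∘ S_t` on configurations
  have h1 : ∀ S : QuadConfig (Set.univ : Set ℂ), QuadConfig.dilate t ht.ne' (QuadConfig.isometry g' S) =
      QuadConfig.isometry g (QuadConfig.dilate t ht.ne' S) := by
    intro S
    ext Q
    rw [mem_quadConfig_dilate_iff, QuadConfig.isometry, QuadConfig.mem_mapHomeomorph,
      QuadConfig.isometry, QuadConfig.mem_mapHomeomorph, mem_quadConfig_dilate_iff]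
    have hQ : (Q.dilate t⁻¹ (inv_ne_zero ht.ne')).mapHomeomorph g'.toHomeomorph.symm =
        (Q.mapHomeomorph g.toHomeomorph.symm).dilate t⁻¹ (inv_ne_zero ht.ne') := by
      ext z
      rw [Quad.mapHomeomorph_apply, IsometryEquiv.coe_toHomeomorph_symm, quad_dilate_apply, hg's,
        quad_dilate_apply, Quad.mapHomeomorph_apply, IsometryEquiv.coe_toHomeomorph_symm,
        Complex.ofReal_inv, mul_inv_cancel_left₀ hτ]
    rw [hQ]
  refine ⟨g', hg', h1, fun S => ?_⟩
  -- `g' ∘ S_{t⁻¹} = S_{t⁻¹} ∘ g`, from `h1` applied to `S_{t⁻¹} S`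
  have h2 := congrArg (QuadConfig.dilate t⁻¹ (inv_ne_zero ht.ne'))
    (h1 (QuadConfig.dilate t⁻¹ (inv_ne_zero ht.ne') S))
  rwa [quadConfig_dilate_inv_dilate, quadConfig_dilate_dilate_inv] at h2

end Summit.CriticalPhenomena.CardyFormulaZ2.Theorems.CardyMeckeFlip

end
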